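import Mathlib.Algebra.Order.BigOperators.Group.Finset
import Mathlib.Algebra.BigOperators.Ring.Finset
import Mathlib.Algebra.Order.Field.Basic
import Mathlib.Data.Finset.Powerset
import Mathlib.Data.Finset.Card
import Mathlib.Data.Real.Basic
import Mathlib.Tactic.Linarith
import Mathlib.Tactic.FieldSimp
import Mathlib.Tactic.Ring
import Mathlib.Tactic.Positivity
import Mathlib.Tactic.Push
import HarnessLib

/-!
# `NoHeavyLowerTail` (stmt-CriticalPhenomena-4575) — the star algebra of the one-layer floor-split CIL

Helper file of lemma factory #5 (`prim-lf-5`, gen 10; memo `run/shared/lean/prim/prim-lf-5/FSCIL-ONELAYER-PROOF.md`,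
Step 1).  `--supports stmt-CriticalPhenomena-4575`.  Pure finite-sum algebra over the "stars" `B ⊆ A` of a
one-layer observer: no measure theory, no definitions, no sorries.

Abstract data: relays `A`, a witness `c ∈ A`; star weights `w(B) ≥ 0`, `Σ_{B ⊆ A} w(B) = 1` (the law of the set of
open ports); the `H`-side numbers `q_v` (`v` small off the observer), `r_B` (the glued star `U(B)` small) and
`n_v(B)` (`v ∉ B` small when the star is `B`); floor weights `φ_a` with `0 ≤ φ_a ≤ w({a})/(w({a}) + Σ_{B ∌ a} w(B))`.
Hypotheses = the STAR ROWS (`FloorSplitStarRows`): `r_B ≤ q_c` (`B ≠ ∅`) and `r_B + q_v − n_v(B) ≤ q_c`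
(`|B| ≥ 2`, `v ∉ B`), plus `q_a ≤ q_c`, `r_{{a}} = q_a`, `n_v(B) = q_v` for `|B| ≤ 1`.
Conclusion = the floor-split inequality `bad ≤ Σ_a φ_a I_a + (μ(o↔A) − Σ_a φ_a)·I_c` with
`bad = Σ_{B≠∅} w(B) r_B`, `I_v = Σ_B w(B)·(r_B if v ∈ B else n_v(B))`, `μ(o↔A) = Σ_{B≠∅} w(B)`.
Proof = the per-star identity of the memo (`ε_a := w{a} − φ_a(1 − ρ_a) ≥ 0`): RHS − LHS = `Σ_a ε_a (q_c − q_a) +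
Σ_{|B|≥2} w(B)·[π(q_c − r_B) + σ'[c∉B](n_c(B) − r_B) + Σ_{a∉B} φ_a (q_c − q_a + n_a(B) − r_B)] ≥ 0`.
-/

namespace Summit.CriticalPhenomena.PercolationContinuityZ3.Theorems

namespace FloorSplitOneLayer

open Finset

variable {ι : Type*} [DecidableEq ι]

/-- The subsets of `A` of size `≤ 1` containing `a ∈ A`: exactly `{a}`. [folklore] -/
theorem filter_powerset_mem_card_le_one (A : Finset ι) {a : ι} (ha : a ∈ A) :
    (A.powerset.filter fun B => a ∈ B ∧ B.card ≤ 1) = {{a}} := by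
  ext B
  simp only [mem_filter, mem_powerset, mem_singleton]
  constructor
  · rintro ⟨-, haB, hcard⟩
    have h1 : B.card = 1 := le_antisymm hcard (Finset.card_pos.2 ⟨a, haB⟩)
    obtain ⟨x, rfl⟩ := Finset.card_eq_one.1 h1
    rw [mem_singleton.1 haB]
  · rintro rfl
    exact ⟨by simpa using ha, mem_singleton_self a, by simp⟩

omit [DecidableEq ι] in
/-- The nonempty subsets of `A` of size `≤ 1` are the singletons: a sum over them is a sum over `A`.
[folklore] -/
theorem sum_powerset_nonempty_card_le_one (A : Finset ι) (F : Finset ι → ℝ) :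
    ∑ B ∈ A.powerset.filter (fun B => B.Nonempty ∧ B.card ≤ 1), F B = ∑ a ∈ A, F {a} := by
  have hset : (A.powerset.filter fun B => B.Nonempty ∧ B.card ≤ 1) =
      A.map ⟨fun x => ({x} : Finset ι), Finset.singleton_injective⟩ := by
    ext B
    simp only [mem_filter, mem_powerset, mem_map, Function.Embedding.coeFn_mk]
    constructor
    · rintro ⟨hBA, hne, hcard⟩
      have h1 : B.card = 1 := le_antisymm hcard (Finset.card_pos.2 hne)
      obtain ⟨x, rfl⟩ := Finset.card_eq_one.1 h1
      exact ⟨x, by simpa using hBA, rfl⟩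
    · rintro ⟨x, hx, rfl⟩
      exact ⟨by simpa using hx, singleton_nonempty x, by simp⟩
  rw [hset, sum_map]
  rfl

/-- Splitting a sum over the subsets of `A` into `∅`, the singletons, and the subsets of size `≥ 2`.
[folklore] -/
theorem sum_powerset_split (A : Finset ι) (F : Finset ι → ℝ) :
    ∑ B ∈ A.powerset, F B =
      F ∅ + ∑ a ∈ A, F {a} + ∑ B ∈ A.powerset.filter (fun B => 2 ≤ B.card), F B := by
  rw [← sum_filter_add_sum_filter_not A.powerset (fun B => B.card ≤ 1)]
  have h2 : (A.powerset.filter fun B => ¬ B.card ≤ 1) = A.powerset.filter fun B => 2 ≤ B.card := by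
    ext B; simp only [mem_filter, not_le]; rfl
  rw [h2, ← sum_filter_add_sum_filter_not (A.powerset.filter fun B => B.card ≤ 1) (fun B => B.Nonempty)]
  have h3 : ((A.powerset.filter fun B => B.card ≤ 1).filter fun B => B.Nonempty) =
      A.powerset.filter fun B => B.Nonempty ∧ B.card ≤ 1 := by
    ext B; simp only [mem_filter]; tauto
  have h4 : ((A.powerset.filter fun B => B.card ≤ 1).filter fun B => ¬ B.Nonempty) = {∅} := by
    ext B
    simp only [mem_filter, mem_powerset, not_nonempty_iff_eq_empty, mem_singleton]
    constructor
    · rintro ⟨⟨-, -⟩, rfl⟩; rfl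
    · rintro rfl; exact ⟨⟨empty_subset A, by simp⟩, rfl⟩
  rw [h3, h4, sum_powerset_nonempty_card_le_one, sum_singleton]
  ring

/-- For `B ⊆ A`: `Σ_{a ∈ A, a ∉ B} ψ_a = Σ_{a∈A} ψ_a − Σ_{a ∈ B} ψ_a`. [folklore] -/
theorem sum_filter_not_mem_eq (A B : Finset ι) (hBA : B ⊆ A) (ψ : ι → ℝ) :
    ∑ a ∈ A.filter (fun a => a ∉ B), ψ a = ∑ a ∈ A, ψ a - ∑ a ∈ B, ψ a := by
  have hf : A.filter (fun a => a ∈ B) = B := by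
    ext a; simp only [mem_filter]; exact ⟨fun h => h.2, fun h => ⟨hBA h, h⟩⟩
  have e := sum_filter_add_sum_filter_not A (fun a => a ∈ B) ψ
  rw [hf] at e
  linarith

/-- For `B ⊆ A`: `Σ_{a ∈ A} φ_a·(if a ∈ B then x else y_a) = x·Σ_{a∈B} φ_a + Σ_{a ∈ A, a ∉ B} φ_a y_a`.
[folklore] -/
theorem sum_ite_mem_eq (A B : Finset ι) (hBA : B ⊆ A) (φ : ι → ℝ) (x : ℝ) (y : ι → ℝ) :
    ∑ a ∈ A, φ a * (if a ∈ B then x else y a) =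
      x * ∑ a ∈ B, φ a + ∑ a ∈ A.filter (fun a => a ∉ B), φ a * y a := by
  rw [← sum_filter_add_sum_filter_not A (fun a => a ∈ B)]
  have hf : A.filter (fun a => a ∈ B) = B := by
    ext a; simp only [mem_filter]; exact ⟨fun h => h.2, fun h => ⟨hBA h, h⟩⟩
  rw [hf, mul_sum]
  congr 1
  · exact sum_congr rfl fun a ha => by rw [if_pos ha, mul_comm]
  · exact sum_congr rfl fun a ha => by rw [if_neg (mem_filter.1 ha).2]

/-- Exchange: `Σ_{a∈A} ψ_a Σ_{B ∈ PP, a ∈ B} G(B) = Σ_{B ∈ PP} G(B) Σ_{a ∈ B} ψ_a` for a family `PP` of subsets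
of `A`. [folklore] -/
theorem sum_mul_sum_filter_mem (A : Finset ι) (PP : Finset (Finset ι)) (hPP : ∀ B ∈ PP, B ⊆ A)
    (ψ : ι → ℝ) (G : Finset ι → ℝ) :
    ∑ a ∈ A, ψ a * ∑ B ∈ PP.filter (fun B => a ∈ B), G B = ∑ B ∈ PP, G B * ∑ a ∈ B, ψ a := by
  calc ∑ a ∈ A, ψ a * ∑ B ∈ PP.filter (fun B => a ∈ B), G B
      = ∑ a ∈ A, ∑ B ∈ PP, (if a ∈ B then ψ a * G B else 0) := by
        refine sum_congr rfl fun a _ => ?_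
        rw [mul_sum, sum_filter]
    _ = ∑ B ∈ PP, ∑ a ∈ A, (if a ∈ B then ψ a * G B else 0) := sum_comm
    _ = ∑ B ∈ PP, G B * ∑ a ∈ B, ψ a := by
        refine sum_congr rfl fun B hB => ?_
        rw [← sum_filter]
        have hf : A.filter (fun a => a ∈ B) = B := by
          ext a; simp only [mem_filter]; exact ⟨fun h => h.2, fun h => ⟨hPP B hB h, h⟩⟩
        rw [hf, mul_sum]
        exact sum_congr rfl fun a _ => mul_comm _ _

omit [DecidableEq ι] in
/-- Exchange: `Σ_{a∈A} ψ_a Σ_{B ∈ PP} G(a,B) = Σ_{B ∈ PP} Σ_{a ∈ A} ψ_a G(a,B)`. [folklore] -/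
theorem sum_mul_sum_comm (A : Finset ι) (PP : Finset (Finset ι)) (ψ : ι → ℝ) (G : ι → Finset ι → ℝ) :
    ∑ a ∈ A, ψ a * ∑ B ∈ PP, G a B = ∑ B ∈ PP, ∑ a ∈ A, ψ a * G a B := by
  simp only [mul_sum]
  exact sum_comm

/-- **The star algebra of the one-layer floor-split CIL** (memo FSCIL-ONELAYER-PROOF.md, Step 1 + assembly).
Abstract form: star weights `w ≥ 0` summing to `1` over the subsets of `A`; `H`-numbers `q, r, n` with
`r_{{a}} = q_a`, `n_v(B) = q_v` for `|B| ≤ 1`, `q_a ≤ q_c`; the star rows `r_B ≤ q_c` (`B ≠ ∅`) and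
`r_B + q_v − n_v(B) ≤ q_c` (`|B| ≥ 2`, `v ∈ A ∖ B`); floor weights `0 ≤ φ_a ≤ w{a}/(w{a} + Σ_{B∌a} w)`.  Then
`Σ_{B≠∅} w r ≤ Σ_a φ_a I_a + (Σ_{B≠∅} w − Σ_a φ_a)·I_c`, `I_v = Σ_B w·(r_B if v∈B else n_v(B))`. [this work] -/
theorem starAlgebra (A : Finset ι) (c : ι) (hc : c ∈ A)
    (w : Finset ι → ℝ) (q : ι → ℝ) (r : Finset ι → ℝ) (n : ι → Finset ι → ℝ) (φ : ι → ℝ)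
    (hw0 : ∀ B ∈ A.powerset, 0 ≤ w B) (hw1 : ∑ B ∈ A.powerset, w B = 1)
    (hr1 : ∀ a ∈ A, r {a} = q a)
    (hn1 : ∀ v ∈ A, ∀ B ∈ A.powerset, B.card ≤ 1 → v ∉ B → n v B = q v)
    (hq : ∀ a ∈ A, q a ≤ q c)
    (hrow0 : ∀ B ∈ A.powerset, B.Nonempty → r B ≤ q c)
    (hrow : ∀ B ∈ A.powerset, 2 ≤ B.card → ∀ v ∈ A, v ∉ B → r B + q v - n v B ≤ q c)
    (hφ0 : ∀ a ∈ A, 0 ≤ φ a)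
    (hφ1 : ∀ a ∈ A, φ a ≤ w {a} / (w {a} + ∑ B ∈ A.powerset.filter (fun B => a ∉ B), w B)) :
    ∑ B ∈ A.powerset.filter (fun B => B.Nonempty), w B * r B ≤
      ∑ a ∈ A, φ a * ∑ B ∈ A.powerset, w B * (if a ∈ B then r B else n a B) +
        ((∑ B ∈ A.powerset.filter (fun B => B.Nonempty), w B) - ∑ a ∈ A, φ a) *
          ∑ B ∈ A.powerset, w B * (if c ∈ B then r B else n c B) := by
  -- the family of multi-stars
  set P2 : Finset (Finset ι) := A.powerset.filter (fun B => 2 ≤ B.card) with hP2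
  have hP2P : ∀ B ∈ P2, B ∈ A.powerset := fun B hB => (mem_filter.1 hB).1
  have hP2A : ∀ B ∈ P2, B ⊆ A := fun B hB => mem_powerset.1 (hP2P B hB)
  have hP2w : ∀ B ∈ P2, 0 ≤ w B := fun B hB => hw0 B (mem_filter.1 hB).1
  have hP2c : ∀ B ∈ P2, 2 ≤ B.card := fun B hB => (mem_filter.1 hB).2
  -- atoms
  set π : ℝ := w ∅ with hπ
  set S : ℝ := ∑ a ∈ A, w {a} with hS
  set W₂ : ℝ := ∑ B ∈ P2, w B with hW₂
  set Φ : ℝ := ∑ a ∈ A, φ a with hΦ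
  set Φq : ℝ := ∑ a ∈ A, φ a * q a with hΦq
  set X1 : ℝ := ∑ a ∈ A, w {a} * q a with hX1
  set R2in : ℝ := ∑ B ∈ P2.filter (fun B => c ∈ B), w B * r B with hR2in
  set R2out : ℝ := ∑ B ∈ P2.filter (fun B => c ∉ B), w B * r B with hR2out
  set Rφ : ℝ := ∑ B ∈ P2, w B * r B * ∑ a ∈ B, φ a with hRφ
  set Wφ : ℝ := ∑ B ∈ P2, w B * ∑ a ∈ B, φ a with hWφ
  set Qφ : ℝ := ∑ B ∈ P2, w B * ∑ a ∈ B, φ a * q a with hQφ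
  set NN : ℝ := ∑ B ∈ P2, w B * ∑ a ∈ A.filter (fun a => a ∉ B), φ a * n a B with hNN
  set NNc : ℝ := ∑ B ∈ P2.filter (fun B => c ∉ B), w B * n c B with hNNc
  -- basic signs
  have hπ0 : 0 ≤ π := hw0 ∅ (by simp)
  have hS0 : 0 ≤ S := sum_nonneg fun a ha => hw0 {a} (by simpa using ha)
  have hW₂0 : 0 ≤ W₂ := sum_nonneg hP2w
  have hΦ0 : 0 ≤ Φ := sum_nonneg fun a ha => hφ0 a ha
  -- (e) total mass
  have htot : π + S + W₂ = 1 := by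
    rw [← hw1, sum_powerset_split A w]
  have hR2 : ∑ B ∈ P2, w B * r B = R2in + R2out := by
    rw [hR2in, hR2out, sum_filter_add_sum_filter_not]
  -- (a) the left-hand side
  have hLHS : ∑ B ∈ A.powerset.filter (fun B => B.Nonempty), w B * r B = X1 + (R2in + R2out) := by
    have e := sum_powerset_split A (fun B => if B.Nonempty then w B * r B else 0)
    rw [← sum_filter] at e
    have e1 : ∑ a ∈ A, (if ({a} : Finset ι).Nonempty then w {a} * r {a} else 0) = X1 := by
      rw [hX1]
      refine sum_congr rfl fun a ha => ?_
      rw [if_pos (singleton_nonempty a), hr1 a ha]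
    have e2 : ∑ B ∈ P2, (if B.Nonempty then w B * r B else 0) = R2in + R2out := by
      rw [← hR2]
      refine sum_congr rfl fun B hB => ?_
      rw [if_pos (Finset.card_pos.1 (by linarith [hP2c B hB]))]
    rw [e, if_neg (by simp), zero_add, e1, e2]
  -- (d) μ(o ↔ A)
  have hPoA : ∑ B ∈ A.powerset.filter (fun B => B.Nonempty), w B = S + W₂ := by
    have e := sum_powerset_split A (fun B => if B.Nonempty then w B else 0)
    rw [← sum_filter] at e
    have e1 : ∑ a ∈ A, (if ({a} : Finset ι).Nonempty then w {a} else 0) = S := by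
      rw [hS]
      exact sum_congr rfl fun a _ => by rw [if_pos (singleton_nonempty a)]
    have e2 : ∑ B ∈ P2, (if B.Nonempty then w B else 0) = W₂ := by
      rw [hW₂]
      refine sum_congr rfl fun B hB => ?_
      rw [if_pos (Finset.card_pos.1 (by linarith [hP2c B hB]))]
    rw [e, if_neg (by simp), zero_add, e1, e2]
  -- (b) Σ_a φ_a I_a = (π + S)Φq + Rφ + NN
  have hg : ∀ B ∈ A.powerset, B.card ≤ 1 →
      ∑ a ∈ A, φ a * (if a ∈ B then r B else n a B) = Φq := by
    intro B hB hcard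
    refine sum_congr rfl fun a ha => ?_
    by_cases haB : a ∈ B
    · rw [if_pos haB]
      have h1 : B.card = 1 := le_antisymm hcard (Finset.card_pos.2 ⟨a, haB⟩)
      obtain ⟨x, rfl⟩ := Finset.card_eq_one.1 h1
      have hxa : x = a := (mem_singleton.1 haB).symm
      subst hxa
      rw [hr1 x ha]
    · rw [if_neg haB, hn1 a ha B hB hcard haB]
  have hI : ∑ a ∈ A, φ a * ∑ B ∈ A.powerset, w B * (if a ∈ B then r B else n a B) =
      (π + S) * Φq + Rφ + NN := by
    rw [sum_mul_sum_comm]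
    have inner : ∀ B ∈ A.powerset, ∑ a ∈ A, φ a * (w B * (if a ∈ B then r B else n a B)) =
        w B * ∑ a ∈ A, φ a * (if a ∈ B then r B else n a B) := by
      intro B _
      rw [mul_sum]
      exact sum_congr rfl fun a _ => by ring
    rw [sum_congr rfl inner, sum_powerset_split A, hg ∅ (by simp) (by simp)]
    have e1 : ∑ a ∈ A, w {a} * ∑ x ∈ A, φ x * (if x ∈ ({a} : Finset ι) then r {a} else n x {a}) = S * Φq := by
      rw [hS, sum_mul]
      exact sum_congr rfl fun a ha => by rw [hg {a} (by simpa using ha) (by simp)]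
    have e2 : ∑ B ∈ P2, w B * ∑ a ∈ A, φ a * (if a ∈ B then r B else n a B) = Rφ + NN := by
      rw [hRφ, hNN, ← sum_add_distrib]
      refine sum_congr rfl fun B hB => ?_
      rw [sum_ite_mem_eq A B (hP2A B hB) φ (r B) (fun a => n a B)]
      ring
    rw [e1, e2, hπ]
    ring
  -- (c) I_c = (π + S) q_c + R2in + NNc
  have hh : ∀ B ∈ A.powerset, B.card ≤ 1 → (if c ∈ B then r B else n c B) = q c := by
    intro B hB hcard
    by_cases hcB : c ∈ B
    · rw [if_pos hcB]
      have h1 : B.card = 1 := le_antisymm hcard (Finset.card_pos.2 ⟨c, hcB⟩)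
      obtain ⟨x, rfl⟩ := Finset.card_eq_one.1 h1
      have hxc : x = c := (mem_singleton.1 hcB).symm
      rw [hxc, hr1 c hc]
    · rw [if_neg hcB, hn1 c hc B hB hcard hcB]
  have hIc : ∑ B ∈ A.powerset, w B * (if c ∈ B then r B else n c B) = (π + S) * q c + R2in + NNc := by
    rw [sum_powerset_split A, hh ∅ (by simp) (by simp)]
    have e1 : ∑ a ∈ A, w {a} * (if c ∈ ({a} : Finset ι) then r {a} else n c {a}) = S * q c := by
      rw [hS, sum_mul]
      exact sum_congr rfl fun a ha => by rw [hh {a} (by simpa using ha) (by simp)]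
    have e2 : ∑ B ∈ P2, w B * (if c ∈ B then r B else n c B) = R2in + NNc := by
      rw [hR2in, hNNc, ← sum_filter_add_sum_filter_not P2 (fun B => c ∈ B)]
      congr 1
      · exact sum_congr rfl fun B hB => by rw [if_pos (mem_filter.1 hB).2]
      · exact sum_congr rfl fun B hB => by rw [if_neg (mem_filter.1 hB).2]
    rw [e1, e2, hπ]
    ring
  -- (f) the floor-weight constraint: φ_a (1 − ρ_a) ≤ w{a}, ρ_a = Σ_{B∈P2, a∈B} w B
  have hcompl : ∀ a ∈ A, w {a} + ∑ B ∈ A.powerset.filter (fun B => a ∉ B), w B =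
      1 - ∑ B ∈ P2.filter (fun B => a ∈ B), w B := by
    intro a ha
    have e1 := sum_filter_add_sum_filter_not A.powerset (fun B => a ∈ B) w
    have e2 := sum_filter_add_sum_filter_not (A.powerset.filter fun B => a ∈ B) (fun B => B.card ≤ 1) w
    have e3 : ((A.powerset.filter fun B => a ∈ B).filter fun B => B.card ≤ 1) = {{a}} := by
      rw [filter_filter]; exact filter_powerset_mem_card_le_one A ha
    have e4 : ((A.powerset.filter fun B => a ∈ B).filter fun B => ¬ B.card ≤ 1) =
        P2.filter fun B => a ∈ B := by
      ext B; simp only [mem_filter, hP2, not_le]; constructor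
      · rintro ⟨⟨h1, h2⟩, h3⟩; exact ⟨⟨h1, h3⟩, h2⟩
      · rintro ⟨⟨h1, h3⟩, h2⟩; exact ⟨⟨h1, h2⟩, h3⟩
    rw [e3, e4, sum_singleton] at e2
    linarith [hw1, e1, e2]
  have hρle : ∀ a ∈ A, ∑ B ∈ P2.filter (fun B => a ∈ B), w B ≤ W₂ := fun a _ =>
    sum_le_sum_of_subset_of_nonneg (filter_subset _ _) fun B hB _ => hP2w B hB
  have hε : ∀ a ∈ A, φ a * (1 - ∑ B ∈ P2.filter (fun B => a ∈ B), w B) ≤ w {a} := by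
    intro a ha
    have hden0 : 0 ≤ w {a} + ∑ B ∈ A.powerset.filter (fun B => a ∉ B), w B :=
      add_nonneg (hw0 {a} (by simpa using ha)) (sum_nonneg fun B hB => hw0 B (mem_filter.1 hB).1)
    rw [← hcompl a ha]
    have h1 := hφ1 a ha
    rcases hden0.eq_or_lt with h0 | hpos
    · rw [← h0, mul_zero]; exact hw0 {a} (by simpa using ha)
    · exact (le_div_iff₀ hpos).1 h1
  -- exchange identities
  have hρφ : ∑ a ∈ A, φ a * ∑ B ∈ P2.filter (fun B => a ∈ B), w B = Wφ :=
    sum_mul_sum_filter_mem A P2 hP2A φ w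
  have hρφq : ∑ a ∈ A, (φ a * q a) * ∑ B ∈ P2.filter (fun B => a ∈ B), w B = Qφ :=
    sum_mul_sum_filter_mem A P2 hP2A (fun a => φ a * q a) w
  -- the ε-sum is nonnegative: Σ_a ε_a (q_c − q_a) ≥ 0, expanded in atoms
  have hεsum : 0 ≤ S * q c - X1 - Φ * q c + q c * Wφ + Φq - Qφ := by
    have hterm : ∀ a ∈ A,
        0 ≤ (w {a} - φ a * (1 - ∑ B ∈ P2.filter (fun B => a ∈ B), w B)) * (q c - q a) :=
      fun a ha => mul_nonneg (by linarith [hε a ha]) (by linarith [hq a ha])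
    have hsum := sum_nonneg hterm
    have hexp : ∑ a ∈ A, (w {a} - φ a * (1 - ∑ B ∈ P2.filter (fun B => a ∈ B), w B)) * (q c - q a) =
        S * q c - X1 - Φ * q c + q c * Wφ + Φq - Qφ := by
      have e : ∀ a ∈ A, (w {a} - φ a * (1 - ∑ B ∈ P2.filter (fun B => a ∈ B), w B)) * (q c - q a) =
          q c * w {a} - w {a} * q a - q c * φ a + q c * (φ a * ∑ B ∈ P2.filter (fun B => a ∈ B), w B) +
            φ a * q a - (φ a * q a) * ∑ B ∈ P2.filter (fun B => a ∈ B), w B := fun a _ => by ring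
      rw [sum_congr rfl e, sum_sub_distrib, sum_add_distrib, sum_add_distrib, sum_sub_distrib,
        sum_sub_distrib, ← mul_sum, ← mul_sum, ← mul_sum, hρφ, hρφq, ← hS, ← hX1, ← hΦ, ← hΦq]
      ring
    rw [← hexp]; exact hsum
  -- σ' ≥ 0
  have hσ : 0 ≤ S + W₂ - Φ := by
    have hΦb : Φ * (1 - W₂) ≤ S := by
      rw [hΦ, sum_mul, hS]
      refine sum_le_sum fun a ha => le_trans ?_ (hε a ha)
      exact mul_le_mul_of_nonneg_left (by linarith [hρle a ha]) (hφ0 a ha)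
    by_cases hW1 : W₂ = 1
    · -- all the mass sits on multi-stars: every `w{a}` vanishes and `φ_a ≤ 0/… = 0`
      have hS' : S = 0 := by linarith [htot]
      have hwa : ∀ a ∈ A, w {a} = 0 := by
        have := (sum_eq_zero_iff_of_nonneg (fun a ha => hw0 {a} (by simpa using ha))).1 (hS ▸ hS')
        exact this
      have hφle : ∀ a ∈ A, φ a ≤ 0 := by
        intro a ha
        have := hφ1 a ha
        rw [hwa a ha, zero_div] at this
        exact this
      have : Φ ≤ 0 := by
        rw [hΦ]; exact sum_nonpos hφle
      linarith
    · have hpos : 0 < 1 - W₂ := by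
        rcases (show W₂ ≤ 1 by linarith [htot]).eq_or_lt with h | h
        · exact absurd h hW1
        · linarith
      have key : 0 ≤ (S + W₂ - Φ) * (1 - W₂) := by nlinarith [hΦb, hπ0, hW₂0, htot]
      exact (mul_nonneg_iff_of_pos_right hpos).1 key
  -- the per-star brackets: Σ_{B∈P2} w_B PS(B) ≥ 0, expanded in atoms
  have hPS : 0 ≤ π * q c * W₂ - π * (R2in + R2out) + (S + W₂ - Φ) * (NNc - R2out) +
      q c * (W₂ * Φ - Wφ) - (W₂ * Φq - Qφ) + NN - (Φ * (R2in + R2out) - Rφ) := by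
    -- the bracket of a multi-star
    have hbr : ∀ B ∈ P2, 0 ≤ π * (q c - r B) + (S + W₂ - Φ) * (if c ∈ B then 0 else n c B - r B) +
        ∑ a ∈ A.filter (fun a => a ∉ B), φ a * (q c - q a + n a B - r B) := by
      intro B hB
      have h0 : 0 ≤ q c - r B := by linarith [hrow0 B (hP2P B hB) (Finset.card_pos.1 (by linarith [hP2c B hB]))]
      have h1 : 0 ≤ (if c ∈ B then 0 else n c B - r B) := by
        split_ifs with hcB
        · exact le_rfl
        · linarith [hrow B (hP2P B hB) (hP2c B hB) c hc hcB]
      have h2 : 0 ≤ ∑ a ∈ A.filter (fun a => a ∉ B), φ a * (q c - q a + n a B - r B) := by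
        refine sum_nonneg fun a ha => ?_
        obtain ⟨haA, haB⟩ := mem_filter.1 ha
        exact mul_nonneg (hφ0 a haA) (by linarith [hrow B (hP2P B hB) (hP2c B hB) a haA haB])
      exact add_nonneg (add_nonneg (mul_nonneg hπ0 h0) (mul_nonneg hσ h1)) h2
    have hsum : 0 ≤ ∑ B ∈ P2, w B * (π * (q c - r B) + (S + W₂ - Φ) * (if c ∈ B then 0 else n c B - r B) +
        ∑ a ∈ A.filter (fun a => a ∉ B), φ a * (q c - q a + n a B - r B)) :=
      sum_nonneg fun B hB => mul_nonneg (hP2w B hB) (hbr B hB)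
    -- expansion of the sum in atoms
    have hout1 : ∀ B ∈ P2, ∑ a ∈ A.filter (fun a => a ∉ B), φ a = Φ - ∑ a ∈ B, φ a :=
      fun B hB => sum_filter_not_mem_eq A B (hP2A B hB) φ
    have hout2 : ∀ B ∈ P2, ∑ a ∈ A.filter (fun a => a ∉ B), φ a * q a = Φq - ∑ a ∈ B, φ a * q a :=
      fun B hB => sum_filter_not_mem_eq A B (hP2A B hB) (fun a => φ a * q a)
    have e : ∀ B ∈ P2, w B * (π * (q c - r B) + (S + W₂ - Φ) * (if c ∈ B then 0 else n c B - r B) +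
        ∑ a ∈ A.filter (fun a => a ∉ B), φ a * (q c - q a + n a B - r B)) =
        (π * q c) * w B + (-π) * (w B * r B) +
        (S + W₂ - Φ) * (if c ∉ B then w B * n c B - w B * r B else 0) +
        (q c * Φ) * w B + (- q c) * (w B * ∑ a ∈ B, φ a) + (-Φq) * w B + (w B * ∑ a ∈ B, φ a * q a) +
        (w B * ∑ a ∈ A.filter (fun a => a ∉ B), φ a * n a B) +
        (-Φ) * (w B * r B) + (w B * r B * ∑ a ∈ B, φ a) := by
      intro B hB
      have ex : ∑ a ∈ A.filter (fun a => a ∉ B), φ a * (q c - q a + n a B - r B) =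
          q c * ∑ a ∈ A.filter (fun a => a ∉ B), φ a - ∑ a ∈ A.filter (fun a => a ∉ B), φ a * q a +
          ∑ a ∈ A.filter (fun a => a ∉ B), φ a * n a B - r B * ∑ a ∈ A.filter (fun a => a ∉ B), φ a := by
        rw [mul_sum, mul_sum, ← sum_sub_distrib, ← sum_add_distrib, ← sum_sub_distrib]
        exact sum_congr rfl fun a _ => by ring
      rw [ex, hout1 B hB, hout2 B hB]
      split_ifs <;> ring
    have hite : ∑ B ∈ P2, (if c ∉ B then w B * n c B - w B * r B else 0) = NNc - R2out := by
      rw [hNNc, hR2out, ← sum_sub_distrib]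
      exact (sum_filter _ _).symm
    have hexp : ∑ B ∈ P2, w B * (π * (q c - r B) + (S + W₂ - Φ) * (if c ∈ B then 0 else n c B - r B) +
        ∑ a ∈ A.filter (fun a => a ∉ B), φ a * (q c - q a + n a B - r B)) =
        π * q c * W₂ - π * (R2in + R2out) + (S + W₂ - Φ) * (NNc - R2out) +
        q c * (W₂ * Φ - Wφ) - (W₂ * Φq - Qφ) + NN - (Φ * (R2in + R2out) - Rφ) := by
      rw [sum_congr rfl e]
      simp only [sum_add_distrib, ← mul_sum, hite, ← hR2, ← hW₂, ← hWφ, ← hQφ, ← hNN, ← hRφ]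
      ring
    exact hexp ▸ hsum
  -- assembly: RHS − LHS = ε-sum + star-sum
  have hπ' : π = 1 - S - W₂ := by linarith [htot]
  rw [hπ'] at hPS
  rw [hLHS, hI, hPoA, hIc, hπ']
  linarith [hεsum, hPS]

end FloorSplitOneLayer

end Summit.CriticalPhenomena.PercolationContinuityZ3.Theorems
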